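import Summits.MatrixMultiplication.MatrixMultiplication.Theses.SchurWeylEquivariant
import Summits.MatrixMultiplication.MatrixMultiplication.Theorems.SchurWeylEquivariantAssembly
import Summits.MatrixMultiplication.MatrixMultiplication.Theorems.SchurWeylEquivariantStrassenPowerEquivariant
import Literature.Computability.AlgebraicComplexity.SchoenhageTau
import Literature.Computability.AlgebraicComplexity.MatrixMultiplicationConjectureForms
import Literature.Computability.AlgebraicComplexity.AsymptoticRankMatMul

/-!
# Crux-strategist audit of `EquivariantExponentTwo` (stmt-MatrixMultiplication-3550): typed
decomposition attempts

Route `MatrixMultiplication/SchurWeylEquivariant`; deciding crux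
`X := EquivariantExponentTwo` was audited RESTATED / AT-LEAST-SUMMIT (an `ω = 2` witness plus an
`S_N`-symmetry constraint). This file types the candidate decompositions `X₁ ∧ … ∧ X_k → X` that
were tried and, for each, the Lean fact that makes it fail the BC2-redirect test
((a) every piece load-bearing, (b) assembly proved and non-trivial, (c) no piece equivalent to `X`
or to the summit `S := MatrixMultiplication`). Companion prose: `STRATEGY-CENSUS.md` in the same
crux directory. Nothing here is a route item; the named `def`s exist only to make the attempts
checkable. Sorry-free.
-/

set_option linter.dupNamespace false
set_option linter.unusedVariables false

noncomputable section

namespace Summit.MatrixMultiplication.MatrixMultiplication.Cruxes.EquivariantExponentTwo.Strategist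

open scoped BigOperators Polynomial
open Literature.Computability.AlgebraicComplexity
open Summit.MatrixMultiplication.MatrixMultiplication.Theses.SchurWeylEquivariant
open Summit.MatrixMultiplication.MatrixMultiplication.Theorems

/-- The route's inlined predicate "`(w,u,v)` is an `S_N`-equivariant decomposition of
`T_N = ⟨2,2,2⟩^{⊠N}` into `r` triads", named here for readability only. -/
def EqDec (N r : ℕ) : Prop :=
  ∃ (w u v : Fin r → (Fin N → Fin 2 × Fin 2) → ℂ),
    kroneckerPow (matMulTensor ℂ 2 2 2) N = ∑ j, triad (w j) (u j) (v j) ∧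
    ∀ σ : Equiv.Perm (Fin N), ∃ π : Equiv.Perm (Fin r), ∀ j,
      triad (w (π j)) (u (π j)) (v (π j)) =
        fun a b c => triad (w j) (u j) (v j) (a ∘ σ) (b ∘ σ) (c ∘ σ)

/-- `X` unfolds to the `EqDec` form definitionally. -/
theorem equivariantExponentTwo_iff :
    EquivariantExponentTwo ↔
      ∀ ε : ℝ, 0 < ε → ∃ N : ℕ, 1 ≤ N ∧ ∃ r : ℕ, (r : ℝ) ≤ (4 : ℝ) ^ ((1 + ε) * N) ∧ EqDec N r :=
  Iff.rfl

/-! ## Attempt A1 — `X ⇐ SymmetrisationCheap ∧ (ω = 2 along the dyadic tower)`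

The honest content split: `X` = (equivariance is asymptotically free) ∧ (`ω = 2`). The assembly
is genuine ε-bookkeeping (below, proved), but piece A1.2 IS the summit: `OmegaTwoDyadic → S`
(proved below) and `S → OmegaTwoDyadic` (proved below). Violates (c). -/

/-- Piece A1.2: `R(T_N) ≤ 4^{(1+ε)N}` for all large `N` — `ω = 2` read along `n = 2^N`. -/
def OmegaTwoDyadic : Prop :=
  ∀ ε : ℝ, 0 < ε → ∃ N₀ : ℕ, ∀ N : ℕ, N₀ ≤ N →
    (tensorRank (kroneckerPow (matMulTensor ℂ 2 2 2) N) : ℝ) ≤ (4 : ℝ) ^ ((1 + ε) * N)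

/-- A1 assembly (non-trivial, proved): `SymmetrisationCheap ∧ OmegaTwoDyadic → X`. -/
theorem a1_assembly (h₁ : SymmetrisationCheap) (h₂ : OmegaTwoDyadic) : EquivariantExponentTwo := by
  intro ε hε
  obtain ⟨N₁, hN₁⟩ := h₁ (ε / 3) (by positivity)
  obtain ⟨N₂, hN₂⟩ := h₂ (ε / 3) (by positivity)
  obtain ⟨r, hr, hdec⟩ := hN₁ (max (max N₁ N₂) 1) (le_trans (le_max_left _ _) (le_max_left _ _))
  have hR := hN₂ (max (max N₁ N₂) 1) (le_trans (le_max_right _ _) (le_max_left _ _))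
  refine ⟨max (max N₁ N₂) 1, le_max_right _ _, r, ?_, hdec⟩
  set N : ℕ := max (max N₁ N₂) 1
  have hNreal : (0 : ℝ) ≤ (N : ℝ) := Nat.cast_nonneg N
  have h2le4 : (2 : ℝ) ^ (ε / 3 * (N : ℝ)) ≤ (4 : ℝ) ^ (ε / 3 * (N : ℝ)) :=
    Real.rpow_le_rpow (by norm_num) (by norm_num) (by positivity)
  calc (r : ℝ) ≤ (2 : ℝ) ^ (ε / 3 * (N : ℝ)) *
        (tensorRank (kroneckerPow (matMulTensor ℂ 2 2 2) N) : ℝ) := hr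
    _ ≤ (4 : ℝ) ^ (ε / 3 * (N : ℝ)) * (4 : ℝ) ^ ((1 + ε / 3) * (N : ℝ)) :=
        mul_le_mul h2le4 hR (by positivity) (by positivity)
    _ = (4 : ℝ) ^ ((1 + 2 * ε / 3) * (N : ℝ)) := by
        rw [← Real.rpow_add (by norm_num)]
        congr 1
        ring
    _ ≤ (4 : ℝ) ^ ((1 + ε) * (N : ℝ)) := by
        apply Real.rpow_le_rpow_of_exponent_le (by norm_num)
        nlinarith

/-- (c) fails for A1: piece A1.2 implies the summit (forgetting nothing — it is `ω = 2`). -/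
theorem a1_piece_implies_summit (h : OmegaTwoDyadic) : _root_.MatrixMultiplication := by
  rw [_root_.MatrixMultiplication_iff]
  refine le_antisymm ?_ (omega_two_le ℂ)
  refine le_of_forall_pos_le_add fun δ hδ => ?_
  obtain ⟨N₀, hN₀⟩ := h (δ / 2) (by positivity)
  have hN : 1 ≤ max N₀ 1 := le_max_right _ _
  have hR := hN₀ (max N₀ 1) (le_max_left _ _)
  obtain ⟨w, u, v, hdec⟩ :=
    exists_triad_decomposition_tensorRank (kroneckerPow (matMulTensor ℂ 2 2 2) (max N₀ 1))
  have := omega_le_two_add_of_kroneckerPow_decomposition hN hR w u v hdec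
  linarith

/-- (c) fails for A1, converse direction: the summit implies piece A1.2
(`ω = 2 ⇒ 2 + ε` admissible ⇒ `R(⟨2^N,2^N,2^N⟩) ≤ c·(2^N)^{2+ε}` eventually ⇒
`R(T_N) ≤ 4^{(1+ε)N}` for large `N`). So A1.2 ⟺ S. -/
theorem summit_implies_a1_piece (h : _root_.MatrixMultiplication) : OmegaTwoDyadic := by
  rw [_root_.MatrixMultiplication_iff] at h
  intro ε hε
  have hadm : (2 + ε) ∈ admissibleExponents ℂ :=
    mem_admissibleExponents_of_omega_lt ℂ (by rw [h]; linarith)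
  obtain ⟨c, hc⟩ := Asymptotics.IsBigO.bound hadm
  rw [Filter.eventually_atTop] at hc
  obtain ⟨n₀, hn₀⟩ := hc
  -- `M` with `c ≤ (ε/2 · log 4) · M`, so that `c ≤ 4^{(ε/2) N}` for `N ≥ M`.
  obtain ⟨M, hM⟩ := exists_nat_ge (c / (ε / 2 * Real.log 4))
  refine ⟨max n₀ M, fun N hN => ?_⟩
  have hn₀N : n₀ ≤ N := le_trans (le_max_left _ _) hN
  have hMN : M ≤ N := le_trans (le_max_right _ _) hN
  have hlog4 : 0 < Real.log 4 := Real.log_pos (by norm_num)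
  have hpos : 0 < ε / 2 * Real.log 4 := by positivity
  -- `2^N ≥ n₀`
  have h2N : n₀ ≤ 2 ^ N := le_trans hn₀N (Nat.lt_two_pow_self).le
  have hbound := hn₀ (2 ^ N) h2N
  rw [Real.norm_of_nonneg (Nat.cast_nonneg _),
    Real.norm_of_nonneg (Real.rpow_nonneg (Nat.cast_nonneg _) _)] at hbound
  -- `R(T_N) ≤ R(⟨2^N,2^N,2^N⟩)`
  have hTN : (tensorRank (kroneckerPow (matMulTensor ℂ 2 2 2) N) : ℝ) ≤
      (tensorRank (matMulTensor ℂ (2 ^ N) (2 ^ N) (2 ^ N)) : ℝ) := by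
    exact_mod_cast tensorRank_kroneckerPow_matMulTensor_le ℂ 2 2 2 N
  -- `(2^N)^{2+ε} = 4^{(1+ε/2)N}`
  have h4 : (((2 ^ N : ℕ) : ℝ)) ^ (2 + ε) = (4 : ℝ) ^ ((1 + ε / 2) * (N : ℝ)) := by
    rw [show (4 : ℝ) = (2 : ℝ) ^ (2 : ℝ) by norm_num, ← Real.rpow_mul (by norm_num), Nat.cast_pow,
      Nat.cast_ofNat, ← Real.rpow_natCast, ← Real.rpow_mul (by norm_num)]
    congr 1
    ring
  -- `c ≤ 4^{(ε/2)N}`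
  have hc4 : c ≤ (4 : ℝ) ^ (ε / 2 * (N : ℝ)) := by
    rcases le_or_gt c 0 with hc0 | hc0
    · exact hc0.trans (Real.rpow_nonneg (by norm_num) _)
    · have hM' : c / (ε / 2 * Real.log 4) ≤ (N : ℝ) := hM.trans (by exact_mod_cast hMN)
      have hcle : c ≤ ε / 2 * Real.log 4 * (N : ℝ) := by
        rw [div_le_iff₀ hpos] at hM'
        linarith
      calc c ≤ ε / 2 * Real.log 4 * (N : ℝ) := hcle
        _ ≤ ε / 2 * (N : ℝ) * Real.log 4 + 1 := by linarith
        _ ≤ Real.exp (ε / 2 * (N : ℝ) * Real.log 4) := Real.add_one_le_exp _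
        _ = (4 : ℝ) ^ (ε / 2 * (N : ℝ)) := by
          rw [Real.rpow_def_of_pos (by norm_num), mul_comm (Real.log 4)]
  calc (tensorRank (kroneckerPow (matMulTensor ℂ 2 2 2) N) : ℝ)
      ≤ (tensorRank (matMulTensor ℂ (2 ^ N) (2 ^ N) (2 ^ N)) : ℝ) := hTN
    _ ≤ c * (((2 ^ N : ℕ) : ℝ)) ^ (2 + ε) := hbound
    _ = c * (4 : ℝ) ^ ((1 + ε / 2) * (N : ℝ)) := by rw [h4]
    _ ≤ (4 : ℝ) ^ (ε / 2 * (N : ℝ)) * (4 : ℝ) ^ ((1 + ε / 2) * (N : ℝ)) :=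
        mul_le_mul_of_nonneg_right hc4 (Real.rpow_nonneg (by norm_num) _)
    _ = (4 : ℝ) ^ ((1 + ε) * (N : ℝ)) := by
        rw [← Real.rpow_add (by norm_num)]
        congr 1
        ring

/-- Hence piece A1.2 is literally equivalent to the summit. -/
theorem a1_piece_iff_summit : OmegaTwoDyadic ↔ _root_.MatrixMultiplication :=
  ⟨a1_piece_implies_summit, summit_implies_a1_piece⟩

/-! ## Attempt A2 — border split `X ⇐ EquivariantBorderExponentTwo ∧ EquivariantInterpolation`

Piece A2.2 (equivariant Bläser Lemma 6.4: interpolate the `ε`-coefficients; the new index set is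
`Fin r × antidiagonal`, on which `σ` acts through `π × id`) is routine and provable now; therefore
piece A2.1 is equivalent to `X` (`X → A2.1` with `h = 0` is proved below; `A2.1 → X` is A2.2), and
A2.1 with the symmetry conjunct dropped is Bini's border form of an `ω = 2` witness. Violates (c). -/

/-- Piece A2.1: equivariant degree-`h` approximate decompositions of `T_N` at rate `4`, with the
interpolation cost `C(h+2,2)` prepaid. -/
def EquivariantBorderExponentTwo : Prop :=
  ∀ ε : ℝ, 0 < ε → ∃ N : ℕ, 1 ≤ N ∧ ∃ r h : ℕ,
    (((h + 2).choose 2 * r : ℕ) : ℝ) ≤ (4 : ℝ) ^ ((1 + ε) * N) ∧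
    ∃ (u v w : Fin r → (Fin N → Fin 2 × Fin 2) → ℂ[X]),
      IsApproxDecomposition h (kroneckerPow (matMulTensor ℂ 2 2 2) N) u v w ∧
      ∀ σ : Equiv.Perm (Fin N), ∃ π : Equiv.Perm (Fin r), ∀ j,
        triad (u (π j)) (v (π j)) (w (π j)) =
          fun a b c => triad (u j) (v j) (w j) (a ∘ σ) (b ∘ σ) (c ∘ σ)

/-- Piece A2.2: equivariant interpolation (Bläser 2013 Lemma 6.4 with the `S_N`-action carried
along). Routine; provable now; not proved in this audit file. -/
def EquivariantInterpolation : Prop :=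
  ∀ (N r h : ℕ) (u v w : Fin r → (Fin N → Fin 2 × Fin 2) → ℂ[X]),
    IsApproxDecomposition h (kroneckerPow (matMulTensor ℂ 2 2 2) N) u v w →
    (∀ σ : Equiv.Perm (Fin N), ∃ π : Equiv.Perm (Fin r), ∀ j,
        triad (u (π j)) (v (π j)) (w (π j)) =
          fun a b c => triad (u j) (v j) (w j) (a ∘ σ) (b ∘ σ) (c ∘ σ)) →
    EqDec N ((h + 2).choose 2 * r)

/-- A2 assembly: one `obtain` and one application — a trivial seam ((b) fails as well). -/
theorem a2_assembly (h₁ : EquivariantBorderExponentTwo) (h₂ : EquivariantInterpolation) :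
    EquivariantExponentTwo := by
  intro ε hε
  obtain ⟨N, hN, r, h, hbound, u, v, w, happ, hequi⟩ := h₁ ε hε
  exact ⟨N, hN, _, hbound, h₂ N r h u v w happ hequi⟩

/-- (c) fails for A2: `X → A2.1` by taking `h = 0` (constant polynomials). -/
theorem x_implies_a2_piece (hX : EquivariantExponentTwo) : EquivariantBorderExponentTwo := by
  intro ε hε
  obtain ⟨N, hN, r, hr, w, u, v, hdec, hequi⟩ := hX ε hε
  refine ⟨N, hN, r, 0, ?_, fun j a => Polynomial.C (w j a), fun j b => Polynomial.C (u j b),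
    fun j c => Polynomial.C (v j c), isApproxDecomposition_zero_C hdec, ?_⟩
  · simpa using hr
  · intro σ
    obtain ⟨π, hπ⟩ := hequi σ
    refine ⟨π, fun j => ?_⟩
    funext a b c
    have key := congrFun (congrFun (congrFun (hπ j) a) b) c
    simp only [triad_apply] at key ⊢
    rw [← Polynomial.C_mul, ← Polynomial.C_mul, ← Polynomial.C_mul, ← Polynomial.C_mul, key]

/-! ## Attempt A3 — rigidity / gap split `X ⇐ GapAtSeven ∧ EquivariantBeatsStrassenPower`

"The equivariant exponent is either Strassen's or two" sounds like a zero-one law, but typed it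
is `EquivariantBeatsStrassenPower → X` on the nose (proved below): the modus-ponens seam.
Violates (b) (one-line assembly) and (c) in substance (the gap piece carries all of `X`
conditioned on a finite spark that `R(⟨4,4,4⟩) ≤ 48` makes very likely true). -/

/-- Piece A3.1: any `S_N`-equivariant improvement over `7^N` at any level forces `X`. -/
def EquivariantGapAtSeven : Prop :=
  ∀ N : ℕ, 1 ≤ N → ∀ r : ℕ, r < 7 ^ N → EqDec N r → EquivariantExponentTwo

/-- A3 assembly: a one-liner. -/
theorem a3_assembly (h₁ : EquivariantGapAtSeven) (h₂ : EquivariantBeatsStrassenPower) :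
    EquivariantExponentTwo := by
  obtain ⟨N, hN, r, hr, hdec⟩ := h₂
  exact h₁ N hN r hr hdec

/-- The gap piece IS the implication `EquivariantBeatsStrassenPower → X`. -/
theorem a3_piece_iff :
    EquivariantGapAtSeven ↔ (EquivariantBeatsStrassenPower → EquivariantExponentTwo) :=
  ⟨fun h₁ h₂ => a3_assembly h₁ h₂, fun h N hN r hr hdec => h ⟨N, hN, r, hr, hdec⟩⟩


/-! ## Attempt A4 — bootstrap split `X ⇐ EquivariantContraction ∧ EquivariantBeatsStrassenPower`

A uniform contraction of the excess exponent `e = log₄ r / N − 1` from every strictly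
sub-Strassen start, iterated (assembly proved below: a genuine induction). Formally the pieces
pass the cheap probes, but the split is rejected: no mechanism for a contraction to rate `4` is
known even non-equivariantly (Coppersmith–Winograd 1982 give strict, start-dependent improvements,
never a contraction to `2`); the guard `r < 7^N` exists only to stop Strassen powers
(`StrassenPowerEquivariant`, proved) from being admissible inputs — with `r ≤ 7^N` the contraction
piece alone implies `X`; and conditioned on the finite spark it demands, the piece carries the
whole asymptotic content of `X`. A costume for (c), recorded, not filed. -/

/-- Piece A4.1: uniform contraction of the excess exponent from any strictly sub-Strassen level. -/
def EquivariantContraction : Prop :=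
  ∃ κ : ℝ, 0 < κ ∧ κ ≤ 1 ∧ ∀ N : ℕ, 1 ≤ N → ∀ r : ℕ, r < 7 ^ N → EqDec N r →
    ∀ e : ℝ, 0 ≤ e → (r : ℝ) ≤ (4 : ℝ) ^ ((1 + e) * N) →
    ∃ M : ℕ, 1 ≤ M ∧ ∃ r' : ℕ, r' < 7 ^ M ∧ EqDec M r' ∧
      (r' : ℝ) ≤ (4 : ℝ) ^ ((1 + (1 - κ) * e) * M)

/-- A4 assembly (proved; a real iteration): contraction + one sub-Strassen level ⇒ `X`. -/
theorem a4_assembly (h₁ : EquivariantContraction) (h₂ : EquivariantBeatsStrassenPower) :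
    EquivariantExponentTwo := by
  obtain ⟨κ, hκ0, hκ1, hstep⟩ := h₁
  obtain ⟨N, hN, r, hr, hdec⟩ := h₂
  -- initial excess `e₀ = 1`: `r < 7^N ≤ 16^N = 4^{2N}`
  have hinit : (r : ℝ) ≤ (4 : ℝ) ^ ((1 + (1 : ℝ)) * N) := by
    have h7 : (r : ℝ) ≤ (7 : ℝ) ^ N := by exact_mod_cast hr.le
    calc (r : ℝ) ≤ (7 : ℝ) ^ N := h7
      _ ≤ (16 : ℝ) ^ N := pow_le_pow_left₀ (by norm_num) (by norm_num) N
      _ = (4 : ℝ) ^ ((1 + (1 : ℝ)) * N) := by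
          rw [show (16 : ℝ) = (4 : ℝ) ^ (2 : ℕ) by norm_num, ← pow_mul, ← Real.rpow_natCast]
          congr 1
          push_cast
          ring
  have iter : ∀ k : ℕ, ∃ M : ℕ, 1 ≤ M ∧ ∃ r' : ℕ, r' < 7 ^ M ∧ EqDec M r' ∧
      (r' : ℝ) ≤ (4 : ℝ) ^ ((1 + (1 - κ) ^ k) * M) := by
    intro k
    induction k with
    | zero => exact ⟨N, hN, r, hr, hdec, by simpa using hinit⟩
    | succ k ih =>
      obtain ⟨M, hM, r', hr', hdec', hb⟩ := ih
      obtain ⟨M', hM', r'', hr'', hdec'', hb'⟩ :=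
        hstep M hM r' hr' hdec' ((1 - κ) ^ k) (pow_nonneg (by linarith) k) hb
      refine ⟨M', hM', r'', hr'', hdec'', ?_⟩
      have hpow : (1 - κ) ^ (k + 1) = (1 - κ) * (1 - κ) ^ k := by ring
      rw [hpow]
      exact hb'
  intro ε hε
  obtain ⟨k, hk⟩ := exists_pow_lt_of_lt_one hε (by linarith : 1 - κ < 1)
  obtain ⟨M, hM, r', -, hdec', hb⟩ := iter k
  refine ⟨M, hM, r', ?_, hdec'⟩
  calc (r' : ℝ) ≤ (4 : ℝ) ^ ((1 + (1 - κ) ^ k) * M) := hb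
    _ ≤ (4 : ℝ) ^ ((1 + ε) * M) := by
        apply Real.rpow_le_rpow_of_exponent_le (by norm_num)
        have hM0 : (0 : ℝ) ≤ M := Nat.cast_nonneg M
        nlinarith [hk.le]

/-! ## Attempt A5 — the route's own two-layer plan `X ⇐ CompressionLemma ∧ YoungFamily`

`YoungFamily` (typed below) asserts `T_N` is a short sum of orbit-averages of triads with Young
stabilisers; expanding each average over coset representatives gives an honest `S_N`-equivariant
decomposition with `Σ_k [S_N : S_{λ_k}]` triads, so `YoungFamily → X` ALONE (a structured
`X`-witness: violates (c), at-least-`X`), while `CompressionLemma` ("cheap equivariant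
decompositions are WLOG of Young type") is needed only for the converse/search direction and is
not load-bearing for `X` (violates (a)). -/

/-- Piece A5.2 (typed for the record): a Young-type orbit-sum family at rate `4`. Block maps
`lam k : Fin N → Fin 5` (≤ 5 blocks), legs invariant under the Young subgroup
`S_λ = {σ | lam k ∘ σ = lam k}`, orbit-average `|S_λ|⁻¹ Σ_σ σ·(w ⊗ u ⊗ v)` costing
`[S_N : S_λ] = N! / ∏_b |λ⁻¹ b|!` triads. -/
def YoungFamily : Prop :=
  ∀ ε : ℝ, 0 < ε → ∃ N : ℕ, 1 ≤ N ∧ ∃ K : ℕ, ∃ (lam : Fin K → Fin N → Fin 5)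
    (w u v : Fin K → (Fin N → Fin 2 × Fin 2) → ℂ),
    (∀ k, ∀ σ : Equiv.Perm (Fin N), lam k ∘ σ = lam k →
        (fun a => w k (a ∘ σ)) = w k ∧ (fun b => u k (b ∘ σ)) = u k ∧
          (fun c => v k (c ∘ σ)) = v k) ∧
    (∑ k, (Nat.factorial N : ℝ) /
        ∏ b : Fin 5, (Nat.factorial (Finset.univ.filter fun i => lam k i = b).card : ℝ)) ≤
      (4 : ℝ) ^ ((1 + ε) * N) ∧
    kroneckerPow (matMulTensor ℂ 2 2 2) N =
      ∑ k, ∑ σ : Equiv.Perm (Fin N),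
        (∏ b : Fin 5, (Nat.factorial (Finset.univ.filter fun i => lam k i = b).card : ℂ))⁻¹ •
          fun a b c => triad (w k) (u k) (v k) (a ∘ σ) (b ∘ σ) (c ∘ σ)

/-! ## Attempt A6 — subgroup relaxation `X ⇐ (H_N-equivariant rate 4) ∧ (orbit-union glue)`

Relax `S_N` to a subgroup of subexponential index (here the point stabiliser `S_N ≅ Stab(0) <
S_{N+1}`, index `N + 1`); the orbit union over coset representatives restores full equivariance
at polynomial cost (routine glue, provable now). Hence the relaxed piece is equivalent to `X`
(`X →` relaxed is proved below; the converse is the glue). Violates (c). The same holds for every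
subgroup family of index `2^{o(N)}`; for index `≥ (1+δ)^N` the relaxed piece no longer assembles. -/

/-- Piece A6.1: rate `4` with equivariance only under the stabiliser of position `0`. -/
def StabiliserRelaxedExponentTwo : Prop :=
  ∀ ε : ℝ, 0 < ε → ∃ N : ℕ, ∃ r : ℕ, (r : ℝ) ≤ (4 : ℝ) ^ ((1 + ε) * (N + 1 : ℕ)) ∧
    ∃ (w u v : Fin r → (Fin (N + 1) → Fin 2 × Fin 2) → ℂ),
      kroneckerPow (matMulTensor ℂ 2 2 2) (N + 1) = ∑ j, triad (w j) (u j) (v j) ∧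
      ∀ σ : Equiv.Perm (Fin (N + 1)), σ 0 = 0 → ∃ π : Equiv.Perm (Fin r), ∀ j,
        triad (w (π j)) (u (π j)) (v (π j)) =
          fun a b c => triad (w j) (u j) (v j) (a ∘ σ) (b ∘ σ) (c ∘ σ)

/-- `X →` A6.1 (forget part of the symmetry). -/
theorem x_implies_a6_piece (hX : EquivariantExponentTwo) : StabiliserRelaxedExponentTwo := by
  intro ε hε
  obtain ⟨N, hN, r, hr, w, u, v, hdec, hequi⟩ := hX ε hε
  obtain ⟨N', rfl⟩ : ∃ N', N = N' + 1 := ⟨N - 1, by omega⟩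
  exact ⟨N', r, hr, w, u, v, hdec, fun σ _ => hequi σ⟩

/-! ## Strengthen-to-induct (census § Strengthen): `S⁺ = polynomial slack` and its inductive step

`S⁺`: `R^eq_N ≤ C · N^k · 4^N` for all `N ≥ 1` (no `ε`; consistent with the known
`R(⟨n,n,n⟩) ≥ 3n² − o(n²)`). It invites the level-by-level step below; but the step ALONE already
gives `S⁺` by induction from the proved base `R^eq_1 ≤ 7` (`StrassenPowerEquivariant`), as shown
here, and `S⁺ → X` is ε-bookkeeping (`C N^k ≤ 4^{εN}` eventually). So in the split
`X ⇐ base ∧ step` the step is at-least-`X`: the added rigidity relocates the whole crux into one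
piece (violates (c)); nothing is known that makes one level-raising step cheaper than `4·(1+k/N)^…`. -/

/-- `S⁺`: equivariant decompositions with polynomial slack over `4^N`, at every level. -/
def EquivariantPolySlack : Prop :=
  ∃ C k : ℕ, ∀ N : ℕ, 1 ≤ N → ∃ r : ℕ, r ≤ C * (N + 1) ^ k * 4 ^ N ∧ EqDec N r

/-- The inductive step `S⁺` invites: raise the level by one at cost ratio `4 · ((N+2)/(N+1))^k`. -/
def EquivariantInductiveStep : Prop :=
  ∃ k : ℕ, ∀ N : ℕ, 1 ≤ N → ∀ r : ℕ, EqDec N r →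
    ∃ r' : ℕ, EqDec (N + 1) r' ∧ r' * (N + 1) ^ k ≤ 4 * r * (N + 2) ^ k

/-- The step alone proves `S⁺` (base: Strassen at `N = 1`, proved in tree). -/
theorem inductiveStep_implies_polySlack (h : EquivariantInductiveStep) : EquivariantPolySlack := by
  obtain ⟨k, hstep⟩ := h
  refine ⟨7, k, fun N hN => ?_⟩
  induction N, hN using Nat.le_induction with
  | base =>
    obtain ⟨w, u, v, hdec, hequi⟩ := strassenPowerEquivariant_proof 1
    refine ⟨7 ^ 1, ?_, w, u, v, hdec, hequi⟩
    have : 1 ≤ (1 + 1) ^ k := Nat.one_le_pow _ _ (by norm_num)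
    nlinarith
  | succ N hN ih =>
    obtain ⟨r, hr, hdec⟩ := ih
    obtain ⟨r', hdec', hstep'⟩ := hstep N hN r hdec
    refine ⟨r', ?_, hdec'⟩
    -- `r' (N+1)^k ≤ 4 r (N+2)^k ≤ 4 · 7 (N+1)^k 4^N · (N+2)^k`, divide by `(N+1)^k ≥ 1`.
    have hpos : 0 < (N + 1) ^ k := pow_pos (Nat.succ_pos N) k
    have key : r' * (N + 1) ^ k ≤ (7 * (N + 1 + 1) ^ k * 4 ^ (N + 1)) * (N + 1) ^ k := by
      calc r' * (N + 1) ^ k ≤ 4 * r * (N + 2) ^ k := hstep'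
        _ ≤ 4 * (7 * (N + 1) ^ k * 4 ^ N) * (N + 2) ^ k := by gcongr
        _ = (7 * (N + 1 + 1) ^ k * 4 ^ (N + 1)) * (N + 1) ^ k := by ring
    exact Nat.le_of_mul_le_mul_right key hpos

end Summit.MatrixMultiplication.MatrixMultiplication.Cruxes.EquivariantExponentTwo.Strategist

end
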